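import Mathlib
import Literature.Barriers.MatrixMultiplication.NormalizerBarrier
import Summits.MatrixMultiplication.MatrixMultiplication.Theorems.SubgroupIdentityDesigns.Negative.BlockSliceConfinement
import Summits.MatrixMultiplication.MatrixMultiplication.Theorems.SubgroupIdentityDesigns.Negative.BlockSliceTypes

/-!
# Packing bounds for block-slice type groups (pair bound `|Hᵢ||Hⱼ| ≤ |GL_k| q^{l eᵢⱼ}`)
(negative-side helper for the crux `SubgroupIdentityDesigns`, stmt-MatrixMultiplication-14079; cell B2b-5, gen 9)

Third file of the block-slice packing no-go (BLOCK-SLICES.md §2 of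
`run/shared/lean/b2b/levelgraded-cu/b2b-lgcu-borel-g8/`).  Setting as in `BlockSliceTypes`:
`G = GL (Fin k ⊕ Fin l) F`, `F` a finite field with `q = |F|`, blocks `g = (A B; C D)`, type groups
`G(U,K)` and `A`-stabilisers `St(U,K) ≤ GL_k(F)`.  Proved here (all sorry-free):

* `card_colsIn_le` — matrices with all columns in `U`: at most `|U|^l`;
* `card_ann_eq` — `#{C ∈ F^{l×k} : C K = 0} = q^{l (k - dim K)}` (= linear maps from `F^k/K`);
* `card_typeGroup_le(_pow)` — UPPER BOUND `|G(U,K)| ≤ |St(U,K)| · q^{l (dim U + k - dim K)}`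
  via `g ↦ (A(g), B(g), C(g))`;
* `fromBlocks_mulVec_injective`, `isUnit_glue` — `(A B; C 1)` is invertible when `A ∈ St(U,K)`,
  the columns of `B` lie in `U ≤ K` and `C K = 0`;
* `le_card_inf_typeGroup` — LOWER BOUND
  `|St₁ ∩ St₂| · q^{l dim(U₁ ∩ U₂)} · q^{l (k - dim(K₁ + K₂))} ≤ |G(U₁,K₁) ∩ G(U₂,K₂)|`;
* `pair_bound` — **BLOCK-SLICES Lemma 2.3 for type groups**: if `Hᵢ ≤ G(Uᵢ,Kᵢ)`, `Uᵢ ≤ Kᵢ` and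
  `H₁ ∩ H₂ = 1` then `|H₁| |H₂| ≤ |GL_k(F)| · q^{l (dim(U₁ + U₂) + k - dim(K₁ ∩ K₂))}`
  (confinement `BlockSliceConfinement.confinement` + the two bounds + `|St₁||St₂| ≤ |St₁ ∩ St₂||GL_k|`
  + Grassmann's formula).

The triple theorem `V² ≤ |GL_k|³ q^{5kl}` and its numeric form are in `BlockSliceNoGo`.
VALUE = theorem (helper for a referee-grade no-go), NOT summit progress; the crux item stays open.
-/

set_option linter.dupNamespace false

open scoped MatrixGroups Matrix
open Literature.Barriers.MatrixMultiplication

namespace Summit.MatrixMultiplication.MatrixMultiplication.Theorems.SubgroupIdentityDesigns.Negative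

namespace BlockSlicePacking

open BlockSliceTypes BlockSliceConfinement

variable {F : Type*} [Field F] [Finite F] {k l : ℕ}

/-! ## Counting the `B`-blocks: matrices with columns in `U` -/

/-- Matrices whose columns lie in `U` inject into `Fin l → U`: there are at most `|U|^l` of them. -/
theorem card_colsIn_le (U : Submodule F (Fin k → F)) :
    Nat.card {B : Matrix (Fin k) (Fin l) F // ∀ y, B *ᵥ y ∈ U} ≤ Nat.card U ^ l := by
  classical
  let f : {B : Matrix (Fin k) (Fin l) F // ∀ y, B *ᵥ y ∈ U} → (Fin l → U) :=
    fun B j => ⟨B.1.col j, by rw [← Matrix.mulVec_single_one]; exact B.2 _⟩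
  have hf : Function.Injective f := by
    rintro ⟨B, hB⟩ ⟨B', hB'⟩ h
    apply Subtype.ext
    ext i j
    have := congr_arg (fun g : Fin l → U => ((g j : U) : Fin k → F) i) h
    simpa [f] using this
  calc Nat.card _ ≤ Nat.card (Fin l → U) := Nat.card_le_card_of_injective f hf
    _ = Nat.card U ^ l := by rw [Nat.card_fun, Nat.card_fin]

/-- The matrix with prescribed columns `β j`. -/
def ofCols (β : Fin l → (Fin k → F)) : Matrix (Fin k) (Fin l) F := Matrix.of fun i j => β j i

omit [Finite F] in
/-- If all `β j ∈ U'` then `ofCols β` maps into `U'`. -/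
theorem ofCols_mulVec_mem {U' : Submodule F (Fin k → F)} {β : Fin l → (Fin k → F)}
    (hβ : ∀ j, β j ∈ U') (y : Fin l → F) : ofCols β *ᵥ y ∈ U' := by
  have : ofCols β *ᵥ y = ∑ j, y j • β j := by
    funext i
    simp [ofCols, Matrix.mulVec, dotProduct, Finset.sum_apply, mul_comm]
  rw [this]
  exact U'.sum_mem fun j _ => U'.smul_mem _ (hβ j)

/-! ## Counting the `C`-blocks: matrices killing `K'` -/

/-- Matrices killing `K'` inject into the linear maps from the quotient `F^k / K'`. -/
theorem card_ann_le (K' : Submodule F (Fin k → F)) :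
    Nat.card {C : Matrix (Fin l) (Fin k) F // ∀ x ∈ K', C *ᵥ x = 0} ≤
      Nat.card (((Fin k → F) ⧸ K') →ₗ[F] (Fin l → F)) := by
  let f : {C : Matrix (Fin l) (Fin k) F // ∀ x ∈ K', C *ᵥ x = 0} →
      (((Fin k → F) ⧸ K') →ₗ[F] (Fin l → F)) :=
    fun C => K'.liftQ (Matrix.toLin' C.1) (fun x hx => by
      rw [LinearMap.mem_ker, Matrix.toLin'_apply]; exact C.2 x hx)
  haveI : Finite (((Fin k → F) ⧸ K') →ₗ[F] (Fin l → F)) := Module.finite_of_finite F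
  refine Nat.card_le_card_of_injective f fun C C' h => ?_
  apply Subtype.ext
  apply Matrix.toLin'.injective
  refine LinearMap.ext fun x => ?_
  have := LinearMap.congr_fun h (Submodule.Quotient.mk x)
  simpa [f, Submodule.liftQ_apply] using this

/-- Conversely the linear maps from the quotient inject into the matrices killing `K'`. -/
theorem card_linearMap_le_ann (K' : Submodule F (Fin k → F)) :
    Nat.card (((Fin k → F) ⧸ K') →ₗ[F] (Fin l → F)) ≤
      Nat.card {C : Matrix (Fin l) (Fin k) F // ∀ x ∈ K', C *ᵥ x = 0} := by
  let g : (((Fin k → F) ⧸ K') →ₗ[F] (Fin l → F)) →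
      {C : Matrix (Fin l) (Fin k) F // ∀ x ∈ K', C *ᵥ x = 0} :=
    fun φ => ⟨LinearMap.toMatrix' (φ.comp K'.mkQ), fun x hx => by
      have hx0 : (Submodule.Quotient.mk x : (Fin k → F) ⧸ K') = 0 := by simpa using hx
      rw [← Matrix.toLin'_apply, Matrix.toLin'_toMatrix', LinearMap.comp_apply, Submodule.mkQ_apply,
        hx0, map_zero]⟩
  refine Nat.card_le_card_of_injective g fun φ ψ h => ?_
  have h' : LinearMap.toMatrix' (φ.comp K'.mkQ) = LinearMap.toMatrix' (ψ.comp K'.mkQ) :=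
    congrArg Subtype.val h
  exact Submodule.linearMap_qext _ (LinearMap.toMatrix'.injective h')

omit [Finite F] in
/-- `|Hom(F^k / K', F^l)| = q^{l (k - dim K')}`. -/
theorem card_linearMap_quot (K' : Submodule F (Fin k → F)) :
    Nat.card (((Fin k → F) ⧸ K') →ₗ[F] (Fin l → F)) =
      Nat.card F ^ (l * (k - Module.finrank F K')) := by
  rw [Module.natCard_eq_pow_finrank (K := F), Module.finrank_linearMap, Module.finrank_fin_fun]
  congr 1
  have h := K'.finrank_quotient_add_finrank
  rw [Module.finrank_fin_fun] at h
  rw [mul_comm]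
  congr 1
  omega

/-- `#{C ∈ F^{l×k} : C K' = 0} = q^{l (k - dim K')}`. -/
theorem card_ann_eq (K' : Submodule F (Fin k → F)) :
    Nat.card {C : Matrix (Fin l) (Fin k) F // ∀ x ∈ K', C *ᵥ x = 0} =
      Nat.card F ^ (l * (k - Module.finrank F K')) :=
  le_antisymm ((card_ann_le K').trans (card_linearMap_quot K').le)
    ((card_linearMap_quot (l := l) K').symm.le.trans (card_linearMap_le_ann K'))

/-! ## Upper bound for a type group -/

/-- `|G(U,K)| ≤ |St(U,K)| · |U|^l · #{C : C K = 0}` via `g ↦ (A(g), B(g), C(g))`. -/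
theorem card_typeGroup_le (U K : Submodule F (Fin k → F)) :
    Nat.card (typeGroup (l := l) U K) ≤
      Nat.card (stabGroup U K) *
        (Nat.card U ^ l * Nat.card {C : Matrix (Fin l) (Fin k) F // ∀ x ∈ K, C *ᵥ x = 0}) := by
  classical
  let f : typeGroup (l := l) U K →
      stabGroup U K × ({B : Matrix (Fin k) (Fin l) F // ∀ y, B *ᵥ y ∈ U} ×
        {C : Matrix (Fin l) (Fin k) F // ∀ x ∈ K, C *ᵥ x = 0}) :=
    fun g => (⟨(isUnit_Ablk_of_mem_typeGroup g.2).unit, unit_Ablk_mem_stabGroup g.2⟩,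
      ⟨Bblk (g : GL (Fin k ⊕ Fin l) F), (mem_typeGroup.mp g.2).B_mem⟩,
      ⟨Cblk (g : GL (Fin k ⊕ Fin l) F), (mem_typeGroup.mp g.2).C_K⟩)
  have hf : Function.Injective f := by
    rintro ⟨g, hg⟩ ⟨g', hg'⟩ h
    simp only [f, Prod.mk.injEq, Subtype.mk.injEq] at h
    obtain ⟨hA, hB, hC⟩ := h
    have hA' : Ablk g = Ablk g' := by
      have := congrArg Units.val hA
      rwa [IsUnit.unit_spec, IsUnit.unit_spec] at this
    apply Subtype.ext
    apply Units.ext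
    rw [← fromBlocks_blk g, ← fromBlocks_blk g', hA', hB, hC, (mem_typeGroup.mp hg).D_eq,
      (mem_typeGroup.mp hg').D_eq]
  calc Nat.card (typeGroup (l := l) U K)
      ≤ Nat.card (stabGroup U K × ({B : Matrix (Fin k) (Fin l) F // ∀ y, B *ᵥ y ∈ U} ×
          {C : Matrix (Fin l) (Fin k) F // ∀ x ∈ K, C *ᵥ x = 0})) :=
        Nat.card_le_card_of_injective f hf
    _ = Nat.card (stabGroup U K) * (Nat.card {B : Matrix (Fin k) (Fin l) F // ∀ y, B *ᵥ y ∈ U} *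
          Nat.card {C : Matrix (Fin l) (Fin k) F // ∀ x ∈ K, C *ᵥ x = 0}) := by
        rw [Nat.card_prod, Nat.card_prod]
    _ ≤ _ := by gcongr; exact card_colsIn_le U

/-! ## Lower bound for the intersection of two type groups -/

/-- The block matrix `(A B; C 1)` with `A ∈ St(U,K)`, columns of `B` in `U`, `U ≤ K` and `C K = 0`
is injective (hence invertible): from `A x + B y = 0`, `C x + y = 0` one gets
`x = -A⁻¹ B y ∈ U ≤ K`, so `C x = 0`, `y = 0`, `x = 0`. -/
theorem fromBlocks_mulVec_injective {U K : Submodule F (Fin k → F)} (hUK : U ≤ K)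
    {A : GL (Fin k) F} (hA : A ∈ stabGroup U K) {B : Matrix (Fin k) (Fin l) F}
    (hB : ∀ y, B *ᵥ y ∈ U) {C : Matrix (Fin l) (Fin k) F} (hC : ∀ x ∈ K, C *ᵥ x = 0) :
    Function.Injective (Matrix.fromBlocks (A : Matrix (Fin k) (Fin k) F) B C 1).mulVec := by
  have hAinv : InStab U K A⁻¹ := mem_stabGroup.mp ((stabGroup U K).inv_mem hA)
  have hinvA : ∀ z : Fin k → F,
      ((A⁻¹ : GL (Fin k) F) : Matrix (Fin k) (Fin k) F) *ᵥ ((A : Matrix (Fin k) (Fin k) F) *ᵥ z)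
        = z := by
    intro z; rw [Matrix.mulVec_mulVec, Units.inv_mul, Matrix.one_mulVec]
  have key : ∀ w : Fin k ⊕ Fin l → F,
      Matrix.fromBlocks (A : Matrix (Fin k) (Fin k) F) B C 1 *ᵥ w = 0 → w = 0 := by
    intro w hw
    rw [Matrix.fromBlocks_mulVec] at hw
    have h1 : (A : Matrix (Fin k) (Fin k) F) *ᵥ (w ∘ Sum.inl) + B *ᵥ (w ∘ Sum.inr) = 0 := by
      funext i; simpa using congr_fun hw (Sum.inl i)
    have h2 : C *ᵥ (w ∘ Sum.inl) + (w ∘ Sum.inr) = 0 := by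
      funext i; simpa using congr_fun hw (Sum.inr i)
    have hxU : w ∘ Sum.inl ∈ U := by
      have hAx : (A : Matrix (Fin k) (Fin k) F) *ᵥ (w ∘ Sum.inl) = -(B *ᵥ (w ∘ Sum.inr)) :=
        eq_neg_of_add_eq_zero_left h1
      rw [← hinvA (w ∘ Sum.inl), hAx, Matrix.mulVec_neg]
      exact U.neg_mem (hAinv.A_U _ (hB _))
    have hCx : C *ᵥ (w ∘ Sum.inl) = 0 := hC _ (hUK hxU)
    have hy : w ∘ Sum.inr = 0 := by rwa [hCx, zero_add] at h2
    have hx : w ∘ Sum.inl = 0 := by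
      rw [hy, Matrix.mulVec_zero, add_zero] at h1
      rw [← hinvA (w ∘ Sum.inl), h1, Matrix.mulVec_zero]
    funext i
    cases i with
    | inl i => exact congr_fun hx i
    | inr i => exact congr_fun hy i
  intro v w hvw
  exact sub_eq_zero.mp (key (v - w) (by rw [Matrix.mulVec_sub, hvw, sub_self]))

/-- The glued block matrix `(A, ofCols β; C, 1)`. -/
def glue (A : GL (Fin k) F) (β : Fin l → (Fin k → F)) (C : Matrix (Fin l) (Fin k) F) :
    Matrix (Fin k ⊕ Fin l) (Fin k ⊕ Fin l) F :=
  Matrix.fromBlocks (A : Matrix (Fin k) (Fin k) F) (ofCols β) C 1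

/-- `glue A β C` is invertible under the type conditions. -/
theorem isUnit_glue {U K : Submodule F (Fin k → F)} (hUK : U ≤ K) {A : GL (Fin k) F}
    (hA : A ∈ stabGroup U K) {β : Fin l → (Fin k → F)} (hβ : ∀ j, β j ∈ U)
    {C : Matrix (Fin l) (Fin k) F} (hC : ∀ x ∈ K, C *ᵥ x = 0) : IsUnit (glue A β C) :=
  Matrix.mulVec_injective_iff_isUnit.mp
    (fromBlocks_mulVec_injective hUK hA (ofCols_mulVec_mem hβ) hC)

omit [Finite F] in
/-- Blocks of the unit attached to an invertible glued matrix. -/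
theorem blk_unit {A : GL (Fin k) F} {β : Fin l → (Fin k → F)} {C : Matrix (Fin l) (Fin k) F}
    (hM : IsUnit (glue A β C)) :
    Ablk hM.unit = (A : Matrix (Fin k) (Fin k) F) ∧ Bblk hM.unit = ofCols β ∧
      Cblk hM.unit = C ∧ Dblk hM.unit = 1 := by
  unfold Ablk Bblk Cblk Dblk
  rw [IsUnit.unit_spec]
  simp [glue]

/-- LOWER BOUND: `|St₁ ⊓ St₂| · |U₁ ⊓ U₂|^l · #{C : C (K₁ + K₂) = 0} ≤ |G(U₁,K₁) ⊓ G(U₂,K₂)|`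
via `(A, β, C) ↦ (A, ofCols β; C, 1)`. -/
theorem le_card_inf_typeGroup {U₁ K₁ U₂ K₂ : Submodule F (Fin k → F)} (h₁ : U₁ ≤ K₁)
    (h₂ : U₂ ≤ K₂) :
    Nat.card ↥(stabGroup U₁ K₁ ⊓ stabGroup U₂ K₂) *
        (Nat.card ↥(U₁ ⊓ U₂) ^ l *
          Nat.card {C : Matrix (Fin l) (Fin k) F // ∀ x ∈ K₁ ⊔ K₂, C *ᵥ x = 0}) ≤
      Nat.card ↥(typeGroup (l := l) U₁ K₁ ⊓ typeGroup U₂ K₂) := by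
  classical
  let X := ↥(stabGroup U₁ K₁ ⊓ stabGroup U₂ K₂) × ((Fin l → ↥(U₁ ⊓ U₂)) ×
    {C : Matrix (Fin l) (Fin k) F // ∀ x ∈ K₁ ⊔ K₂, C *ᵥ x = 0})
  have hunit : ∀ t : X, IsUnit (glue (t.1 : GL (Fin k) F)
      (fun j => ((t.2.1 j : ↥(U₁ ⊓ U₂)) : Fin k → F)) t.2.2.1) := fun t =>
    isUnit_glue h₁ (Subgroup.mem_inf.mp t.1.2).1
      (fun j => (Submodule.mem_inf.mp (t.2.1 j).2).1)
      (fun x hx => t.2.2.2 x (Submodule.mem_sup_left hx))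
  have hmem : ∀ t : X, ((hunit t).unit : GL (Fin k ⊕ Fin l) F) ∈
      typeGroup (l := l) U₁ K₁ ⊓ typeGroup U₂ K₂ := by
    intro t
    have hb := blk_unit (hunit t)
    have hβ : ∀ y, ofCols (fun j => ((t.2.1 j : ↥(U₁ ⊓ U₂)) : Fin k → F)) *ᵥ y ∈ U₁ ⊓ U₂ :=
      ofCols_mulVec_mem fun j => (t.2.1 j).2
    have hS₁ : InStab U₁ K₁ (t.1 : GL (Fin k) F) := mem_stabGroup.mp (Subgroup.mem_inf.mp t.1.2).1
    have hS₂ : InStab U₂ K₂ (t.1 : GL (Fin k) F) := mem_stabGroup.mp (Subgroup.mem_inf.mp t.1.2).2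
    refine Subgroup.mem_inf.mpr ⟨mem_typeGroup.mpr ?_, mem_typeGroup.mpr ?_⟩
    · exact
        { D_eq := hb.2.2.2
          B_mem := fun y => by rw [hb.2.1]; exact (Submodule.mem_inf.mp (hβ y)).1
          C_U := fun x hx => by rw [hb.2.2.1]; exact t.2.2.2 x (Submodule.mem_sup_left (h₁ hx))
          C_K := fun x hx => by rw [hb.2.2.1]; exact t.2.2.2 x (Submodule.mem_sup_left hx)
          A_U := fun x hx => by rw [hb.1]; exact hS₁.A_U x hx
          A_K := fun x hx => by rw [hb.1]; exact hS₁.A_K x hx }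
    · exact
        { D_eq := hb.2.2.2
          B_mem := fun y => by rw [hb.2.1]; exact (Submodule.mem_inf.mp (hβ y)).2
          C_U := fun x hx => by rw [hb.2.2.1]; exact t.2.2.2 x (Submodule.mem_sup_right (h₂ hx))
          C_K := fun x hx => by rw [hb.2.2.1]; exact t.2.2.2 x (Submodule.mem_sup_right hx)
          A_U := fun x hx => by rw [hb.1]; exact hS₂.A_U x hx
          A_K := fun x hx => by rw [hb.1]; exact hS₂.A_K x hx }
  let Φ : X → ↥(typeGroup (l := l) U₁ K₁ ⊓ typeGroup U₂ K₂) := fun t => ⟨(hunit t).unit, hmem t⟩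
  have hΦ : Function.Injective Φ := by
    intro t t' h
    have hM : glue (t.1 : GL (Fin k) F) (fun j => ((t.2.1 j : ↥(U₁ ⊓ U₂)) : Fin k → F)) t.2.2.1 =
        glue (t'.1 : GL (Fin k) F) (fun j => ((t'.2.1 j : ↥(U₁ ⊓ U₂)) : Fin k → F)) t'.2.2.1 := by
      have := congrArg (fun u : ↥(typeGroup (l := l) U₁ K₁ ⊓ typeGroup U₂ K₂) =>
        ((u : GL (Fin k ⊕ Fin l) F) : Matrix (Fin k ⊕ Fin l) (Fin k ⊕ Fin l) F)) h
      simpa [Φ, IsUnit.unit_spec] using this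
    obtain ⟨hA, hB, hC, -⟩ := Matrix.fromBlocks_inj.mp hM
    refine Prod.ext (Subtype.ext (Units.ext hA)) (Prod.ext ?_ (Subtype.ext hC))
    funext j
    apply Subtype.ext
    funext i
    have := congr_fun (congr_fun hB i) j
    simpa [ofCols] using this
  calc Nat.card ↥(stabGroup U₁ K₁ ⊓ stabGroup U₂ K₂) *
        (Nat.card ↥(U₁ ⊓ U₂) ^ l *
          Nat.card {C : Matrix (Fin l) (Fin k) F // ∀ x ∈ K₁ ⊔ K₂, C *ᵥ x = 0})
      = Nat.card X := by
        rw [Nat.card_prod, Nat.card_prod, Nat.card_fun, Nat.card_fin]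
    _ ≤ _ := Nat.card_le_card_of_injective Φ hΦ

/-! ## LEMMA 2.3 for type groups: the pair bound -/

/-- `|G(U,K)| ≤ |St(U,K)| · q^{l (dim U + (k - dim K))}`. -/
theorem card_typeGroup_le_pow (U K : Submodule F (Fin k → F)) :
    Nat.card (typeGroup (l := l) U K) ≤
      Nat.card (stabGroup U K) *
        Nat.card F ^ (l * (Module.finrank F U + (k - Module.finrank F K))) := by
  refine (card_typeGroup_le (l := l) U K).trans (le_of_eq ?_)
  rw [card_ann_eq, Module.natCard_eq_pow_finrank (K := F) (V := U), ← pow_mul, ← pow_add]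
  congr 2
  ring

/-- **PAIR BOUND (BLOCK-SLICES Lemma 2.3 for type groups).**  If `Hᵢ ≤ G(Uᵢ,Kᵢ)` (`Uᵢ ≤ Kᵢ`,
`i = 1,2`) and `H₁ ⊓ H₂ = ⊥` then
`|H₁| · |H₂| ≤ |GL_k(F)| · q^{l (dim(U₁ + U₂) + k - dim(K₁ ∩ K₂))}`. -/
theorem pair_bound {H₁ H₂ : Subgroup (GL (Fin k ⊕ Fin l) F)} {U₁ K₁ U₂ K₂ : Submodule F (Fin k → F)}
    (hU₁ : U₁ ≤ K₁) (hU₂ : U₂ ≤ K₂) (hH₁ : H₁ ≤ typeGroup U₁ K₁) (hH₂ : H₂ ≤ typeGroup U₂ K₂)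
    (hd : Disjoint H₁ H₂) :
    Nat.card H₁ * Nat.card H₂ ≤ Nat.card (GL (Fin k) F) *
      Nat.card F ^ (l * (Module.finrank F ↥(U₁ ⊔ U₂) + (k - Module.finrank F ↥(K₁ ⊓ K₂)))) := by
  -- notation
  set q := Nat.card F with hq
  set w₁ := Module.finrank F U₁ + (k - Module.finrank F K₁) with hw₁
  set w₂ := Module.finrank F U₂ + (k - Module.finrank F K₂) with hw₂
  set w₀ := Module.finrank F ↥(U₁ ⊓ U₂) + (k - Module.finrank F ↥(K₁ ⊔ K₂)) with hw₀
  set e := Module.finrank F ↥(U₁ ⊔ U₂) + (k - Module.finrank F ↥(K₁ ⊓ K₂)) with he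
  set S := Nat.card ↥(stabGroup U₁ K₁ ⊓ stabGroup U₂ K₂) with hS
  -- dimension bookkeeping (Grassmann)
  have gU := Submodule.finrank_sup_add_finrank_inf_eq U₁ U₂
  have gK := Submodule.finrank_sup_add_finrank_inf_eq K₁ K₂
  have bK₁ : Module.finrank F K₁ ≤ k := (Submodule.finrank_le K₁).trans (Module.finrank_fin_fun F).le
  have bK₂ : Module.finrank F K₂ ≤ k := (Submodule.finrank_le K₂).trans (Module.finrank_fin_fun F).le
  have bKs : Module.finrank F ↥(K₁ ⊔ K₂) ≤ k :=
    (Submodule.finrank_le _).trans (Module.finrank_fin_fun F).le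
  have bKi : Module.finrank F ↥(K₁ ⊓ K₂) ≤ k :=
    (Submodule.finrank_le _).trans (Module.finrank_fin_fun F).le
  have hw : w₁ + w₂ = w₀ + e := by omega
  -- the four cardinality bounds
  have conf := confinement hH₁ hH₂ hd
  have up₁ := card_typeGroup_le_pow (l := l) U₁ K₁
  have up₂ := card_typeGroup_le_pow (l := l) U₂ K₂
  have low₀ := le_card_inf_typeGroup (l := l) hU₁ hU₂
  have low : S * q ^ (l * w₀) ≤ Nat.card ↥(typeGroup (l := l) U₁ K₁ ⊓ typeGroup U₂ K₂) := by
    refine le_trans (le_of_eq ?_) low₀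
    rw [card_ann_eq, Module.natCard_eq_pow_finrank (K := F) (V := ↥(U₁ ⊓ U₂)), ← pow_mul,
      ← pow_add]
    congr 2
    rw [hw₀]; ring
  have st := card_mul_card_le_card_inf_mul_card (stabGroup U₁ K₁) (stabGroup U₂ K₂)
  have hpos : 0 < S * q ^ (l * w₀) :=
    Nat.mul_pos Nat.card_pos (Nat.pow_pos Nat.card_pos)
  have key : (S * q ^ (l * w₀)) * (Nat.card H₁ * Nat.card H₂) ≤
      (S * q ^ (l * w₀)) * (Nat.card (GL (Fin k) F) * q ^ (l * e)) :=
    calc (S * q ^ (l * w₀)) * (Nat.card H₁ * Nat.card H₂)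
        = Nat.card H₁ * Nat.card H₂ * (S * q ^ (l * w₀)) := by ring
      _ ≤ Nat.card H₁ * Nat.card H₂ * Nat.card ↥(typeGroup (l := l) U₁ K₁ ⊓ typeGroup U₂ K₂) :=
          Nat.mul_le_mul_left _ low
      _ ≤ Nat.card ↥(typeGroup (l := l) U₁ K₁) * Nat.card ↥(typeGroup (l := l) U₂ K₂) := conf
      _ ≤ (Nat.card ↥(stabGroup U₁ K₁) * q ^ (l * w₁)) *
            (Nat.card ↥(stabGroup U₂ K₂) * q ^ (l * w₂)) := Nat.mul_le_mul up₁ up₂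
      _ = Nat.card ↥(stabGroup U₁ K₁) * Nat.card ↥(stabGroup U₂ K₂) * q ^ (l * (w₁ + w₂)) := by
          rw [Nat.mul_add, pow_add]; ring
      _ ≤ S * Nat.card (GL (Fin k) F) * q ^ (l * (w₁ + w₂)) := Nat.mul_le_mul_right _ st
      _ = (S * q ^ (l * w₀)) * (Nat.card (GL (Fin k) F) * q ^ (l * e)) := by
          rw [hw, Nat.mul_add, pow_add]; ring
  exact Nat.le_of_mul_le_mul_left key hpos

end BlockSlicePacking

end Summit.MatrixMultiplication.MatrixMultiplication.Theorems.SubgroupIdentityDesigns.Negative
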